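import Summits.CriticalPhenomena.PercolationContinuityZ3.Theorems.PercNearOneGluingNoHeavyLowerTailSahiMixtureFourRefutation

/-!
# Where the four-event mixture counterexample lives: the OR-mixture into two of four members is controlled by the cubic row of the DERIVED triple
# `(A_0 ∩ A_1, A_2, A_3)` — the HEREDITARY mixture cell at `(n, |F|) = (4, 2)` is a theorem

Support file of the one-cut programme (crux `NoHeavyLowerTail`, stmt-CriticalPhenomena-4575; cell `prim-masterthm`, seat P3, gen 5;
`run/shared/lean/prim/prim-masterthm/prim-masterthm-p3/HIERARCHY.md` §12 UPDATE).  Continues `…SahiMixtureFourRefutation` (the law-level mixture conjecture fails at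
four events, OR-mixing into two members) and is the law-level form of gen 4's order-4 one-coordinate piece (HIERARCHY §11 UPDATE, "|G| = 2 middle piece").

* **`sahiE_four_orCoin_two_eq`** — the exact identity, for ANY probability weight and ANY four events, with `H` an independent coin of bias `h`:
  `E_4(A_0∪H, A_1∪H, A_2, A_3) = (1−h)²·E_4(A) + 2h(1−h)·X + 2h²·Cov(A_2,A_3)`,
  `X = E_3(1_{A_0}1_{A_1}, 1_{A_2}, 1_{A_3}) + (1 + ½·μ(Ā_0Ā_1))·Cov(A_2,A_3) + μ(Ā_0 ∩ Ā_1 ∩ A_2 ∩ A_3)`.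
* **`bernsteinPos_four_orCoin_two_of_hereditary`** — hence if `E_4(A) ≥ 0`, `Cov(A_2,A_3) ≥ 0` and the HEREDITARY cubic row `E_3(A_0∩A_1, A_2, A_3) ≥ 0` hold, the
  mixture is Bernstein-positive of degree `4`.  The eleven square-free rows of `A` (the hypothesis of the refuted conjecture) do NOT control that derived row:
  **`sahiE_three_derived_cex4`** — on ttrl cp-mix's counterexample law it equals `−27/2450` (and `X = −9/1225`), which is exactly why the cell fails there.
READING (HIERARCHY §12 UPDATE (k)): the natural domain of the mixture programme is the class of laws whose ∩-CLOSED family (all intersections `A_J`, i.e. the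
principal up-sets of the pattern law — Sahi–Blinovsky's monomials) is Sahi-nonnegative at every order; there the known cells are explicit nonnegative combinations,
as at the comb level (gen 4, where Harris supplies the derived rows).  HONEST FRAMING: one cell; the hereditary mixture conjecture itself is open and is not typed here.
[this work]
-/

noncomputable section

open scoped Classical

namespace Summit.CriticalPhenomena.PercolationContinuityZ3.Theorems

open Finset Function
open Literature.Combinatorics.Sahi2008
open Literature.Probability.Percolation.BHK2006 (ind_le_one)
open Literature.Probability.Percolation.DecisionTree (ind ind_of_mem ind_of_not_mem ind_nonneg)

namespace SahiMixture

section Hereditary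

variable {α : Type*} [Fintype α] {μ : α → ℝ} (hμ : ∀ a, 0 ≤ μ a) (hμ1 : ∑ a, μ a = 1) (A0 A1 A2 A3 : Set α)
include hμ1

/-- **The order-4, two-members-mixed identity.**  With `a,b,c,d` the indicators of `A_0..A_3`:
`E_4(A_0∪H, A_1∪H, A_2, A_3) = (1−h)²E_4 + 2h(1−h)[E_3(ab, c, d) + (1 + ½(1 − E a − E b + E ab))(E cd − E c E d) + (E cd − E acd − E bcd + E abcd)] + 2h²(E cd − E c E d)`.
[this work] -/
theorem sahiE_four_orCoin_two_eq (h : ℝ) :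
    sahiE (coinWeight μ h) 4 ![ind (orCoin A0 true), ind (orCoin A1 true), ind (orCoin A2 false), ind (orCoin A3 false)]
      = (1 - h) ^ 2 * sahiE μ 4 ![ind A0, ind A1, ind A2, ind A3]
        + 2 * (h * (1 - h)) * (sahiE μ 3 ![ind A0 * ind A1, ind A2, ind A3]
            + (1 + (1 - ex μ (ind A0) - ex μ (ind A1) + ex μ (ind A0 * ind A1)) / 2) * (ex μ (ind A2 * ind A3) - ex μ (ind A2) * ex μ (ind A3))
            + (ex μ (ind A2 * ind A3) - ex μ (ind A0 * ind A2 * ind A3) - ex μ (ind A1 * ind A2 * ind A3) + ex μ (ind A0 * ind A1 * ind A2 * ind A3)))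
        + 2 * h ^ 2 * (ex μ (ind A2 * ind A3) - ex μ (ind A2) * ex μ (ind A3)) := by
  rw [sahiE_four, sahiE_four, sahiE_three]
  simp only [exc_or₄, exc_or₃, exc_or₂, exc_or₁ μ h hμ1, cond_true, cond_false, one_mul, mul_one, ex_one hμ1]
  ring

include hμ

/-- **The hereditary mixture cell at `(n, |F|) = (4, 2)` is a theorem.**  If `E_4(A) ≥ 0`, `Cov(A_2, A_3) ≥ 0` and the cubic row of the DERIVED triple
`E_3(A_0∩A_1, A_2, A_3) ≥ 0` hold, then OR-ing an independent coin into `A_0, A_1` is Bernstein-positive of degree `4`. [this work] -/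
theorem bernsteinPos_four_orCoin_two_of_hereditary (hE4 : 0 ≤ sahiE μ 4 ![ind A0, ind A1, ind A2, ind A3])
    (hE3d : 0 ≤ sahiE μ 3 ![ind A0 * ind A1, ind A2, ind A3]) (hC23 : ex μ (ind A2) * ex μ (ind A3) ≤ ex μ (ind A2 * ind A3)) :
    BernsteinPos 4 (fun h => sahiE (coinWeight μ h) 4
      ![ind (orCoin A0 true), ind (orCoin A1 true), ind (orCoin A2 false), ind (orCoin A3 false)]) := by
  -- the two defect moments are nonnegative
  have hN01 : 0 ≤ 1 - ex μ (ind A0) - ex μ (ind A1) + ex μ (ind A0 * ind A1) := by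
    have h0 : 0 ≤ ex μ (fun a => (1 - ind A0 a) * (1 - ind A1 a)) :=
      ex_nonneg hμ fun a => mul_nonneg (sub_nonneg.2 (ind_le_one A0 a)) (sub_nonneg.2 (ind_le_one A1 a))
    have e := ex_eq_lin μ (fun a => (1 - ind A0 a) * (1 - ind A1 a)) ![1, -1, -1, 1] ![fun _ => 1, ind A0, ind A1, ind A0 * ind A1]
      (fun a => by simp [Fin.sum_univ_succ]; ring)
    simp only [Fin.sum_univ_succ, Fin.sum_univ_zero, Matrix.cons_val_zero, Matrix.cons_val_succ, ex_const hμ1] at e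
    linarith
  have hD : 0 ≤ ex μ (ind A2 * ind A3) - ex μ (ind A0 * ind A2 * ind A3) - ex μ (ind A1 * ind A2 * ind A3) + ex μ (ind A0 * ind A1 * ind A2 * ind A3) := by
    have h0 : 0 ≤ ex μ (fun a => (1 - ind A0 a) * (1 - ind A1 a) * ind A2 a * ind A3 a) :=
      ex_nonneg hμ fun a => mul_nonneg (mul_nonneg (mul_nonneg (sub_nonneg.2 (ind_le_one A0 a)) (sub_nonneg.2 (ind_le_one A1 a)))
        (ind_nonneg A2 a)) (ind_nonneg A3 a)
    have e := ex_eq_lin μ (fun a => (1 - ind A0 a) * (1 - ind A1 a) * ind A2 a * ind A3 a) ![1, -1, -1, 1]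
      ![ind A2 * ind A3, ind A0 * ind A2 * ind A3, ind A1 * ind A2 * ind A3, ind A0 * ind A1 * ind A2 * ind A3]
      (fun a => by simp [Fin.sum_univ_succ]; ring)
    simp only [Fin.sum_univ_succ, Fin.sum_univ_zero, Matrix.cons_val_zero, Matrix.cons_val_succ] at e
    linarith
  have hC : 0 ≤ ex μ (ind A2 * ind A3) - ex μ (ind A2) * ex μ (ind A3) := sub_nonneg.2 hC23
  have hX : 0 ≤ 2 * (sahiE μ 3 ![ind A0 * ind A1, ind A2, ind A3]
      + (1 + (1 - ex μ (ind A0) - ex μ (ind A1) + ex μ (ind A0 * ind A1)) / 2) * (ex μ (ind A2 * ind A3) - ex μ (ind A2) * ex μ (ind A3))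
      + (ex μ (ind A2 * ind A3) - ex μ (ind A0 * ind A2 * ind A3) - ex μ (ind A1 * ind A2 * ind A3) + ex μ (ind A0 * ind A1 * ind A2 * ind A3))) := by
    have : 0 ≤ (1 + (1 - ex μ (ind A0) - ex μ (ind A1) + ex μ (ind A0 * ind A1)) / 2) * (ex μ (ind A2 * ind A3) - ex μ (ind A2) * ex μ (ind A3)) :=
      mul_nonneg (by linarith) hC
    linarith
  refine ((((bp_g2.smul hE4).add (bp_hg.smul hX)).add (bp_h2.smul (mul_nonneg zero_le_two hC))).mono (by norm_num)).congr fun h _ _ => ?_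
  rw [sahiE_four_orCoin_two_eq hμ1 A0 A1 A2 A3 h]
  ring

end Hereditary

/-! ### On the counterexample law the derived cubic row is negative -/

/-- On ttrl cp-mix's four-event law (all eleven square-free rows `> 0`), the cubic row of the DERIVED triple `(A_0∩A_1, A_2, A_3)` is `−27/2450 < 0` — the
hereditary hypothesis of `bernsteinPos_four_orCoin_two_of_hereditary` fails there, which is where the mixture counterexample lives. [this work] -/
theorem sahiE_three_derived_cex4 : sahiE cex4Weight 3 ![ind (cex4Event 0) * ind (cex4Event 1), ind (cex4Event 2), ind (cex4Event 3)] = -27/2450 := by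
  obtain ⟨m0, m1, m2, m3, m01, m02, m03, m12, m13, m23, m123, m023, m013, m012, m0123⟩ := cex4_moments
  rw [sahiE_three, m2, m3, m01, m23, m012, m013, m0123]
  norm_num

/-- The middle Bernstein quantity `X` of `sahiE_four_orCoin_two_eq` on the counterexample law: `X = −9/1225`. [this work] -/
theorem mixX_cex4 :
    sahiE cex4Weight 3 ![ind (cex4Event 0) * ind (cex4Event 1), ind (cex4Event 2), ind (cex4Event 3)]
      + (1 + (1 - ex cex4Weight (ind (cex4Event 0)) - ex cex4Weight (ind (cex4Event 1)) + ex cex4Weight (ind (cex4Event 0) * ind (cex4Event 1))) / 2)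
          * (ex cex4Weight (ind (cex4Event 2) * ind (cex4Event 3)) - ex cex4Weight (ind (cex4Event 2)) * ex cex4Weight (ind (cex4Event 3)))
      + (ex cex4Weight (ind (cex4Event 2) * ind (cex4Event 3)) - ex cex4Weight (ind (cex4Event 0) * ind (cex4Event 2) * ind (cex4Event 3))
          - ex cex4Weight (ind (cex4Event 1) * ind (cex4Event 2) * ind (cex4Event 3))
          + ex cex4Weight (ind (cex4Event 0) * ind (cex4Event 1) * ind (cex4Event 2) * ind (cex4Event 3))) = -9/1225 := by
  obtain ⟨m0, m1, m2, m3, m01, m02, m03, m12, m13, m23, m123, m023, m013, m012, m0123⟩ := cex4_moments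
  rw [sahiE_three_derived_cex4, m0, m1, m2, m3, m01, m23, m123, m023, m0123]
  norm_num

end SahiMixture

end Summit.CriticalPhenomena.PercolationContinuityZ3.Theorems

end
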